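import Mathlib

/-!
# Quadratic and mixed Newton recursions: step counts — kernel #114 (solo-blind, s63)

Paper §24.62(6)–(8) and §24.63(3′).  The bordered Newton iteration started at the explicit
composite `z_C` (design dials `p_design`) of the thin-box reduced system is observed to converge
in THREE undamped steps at every box number `n` (errors `.176 → .0147 → 6.8e-5 → 6e-10` at
`n = 10³`), with an `n`-UNIFORM quadratic constant `e_{k+1}/e_k² ≈ .31–.33` and a first error
`e₀ ≤ 1/5` (decreasing in `n`).  This file is the elementary tool that turns such measured
constants into step-count statements, in the two forms used there:

* `quad_recursion_bound` — if `0 ≤ e k` and `e (k+1) ≤ C (e k)²` then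
  `C e k ≤ (C e₀)^(2^k)` (digits double), with the error form `quad_recursion_error`,
  the tolerance count `quad_recursion_steps`, the three-step form
  `quad_recursion_three : e 3 ≤ C⁷ e₀⁸`, its monotonicity in the constants, and the
  measured instance `quad_recursion_three_measured : C ≤ 1/3, e₀ ≤ 1/5 ⇒ e 3 < 1.2·10⁻⁹`
  (the observed `6·10⁻¹⁰`); `quad_recursion_exact` records that the bound is attained by the
  extremal recursion `e (k+1) = C (e k)²`;
* `mixed_recursion_geometric` — the inexact / simplified-Newton form
  `e (k+1) ≤ λ e k + C (e k)²` with `λ + C e₀ ≤ q ≤ 1` gives `e k ≤ e₀ q^k`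
  (the one-step certificate of kernel #110 is the case `k = 1`), and
  `mixed_recursion_eventually_small` — the factor improves along the iteration:
  `λ + C e k ≤ λ + C e₀ q^k`.

Pure real analysis, Mathlib only.
-/

namespace Summit.AnomalousDissipation.AnomalousDissipation.Theorems

section Quadratic

/-- **Quadratic recursion, closed form.**  If `0 ≤ e k` and `e (k+1) ≤ C * (e k)^2` for all `k`
(`0 < C`), then `C * e k ≤ (C * e 0) ^ (2 ^ k)`: the number of correct digits doubles per step
once `C * e 0 < 1`. -/
theorem quad_recursion_bound {C : ℝ} {e : ℕ → ℝ} (hC : 0 < C) (hpos : ∀ k, 0 ≤ e k)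
    (hstep : ∀ k, e (k + 1) ≤ C * e k ^ 2) : ∀ k, C * e k ≤ (C * e 0) ^ (2 ^ k) := by
  intro k
  induction k with
  | zero => simp
  | succ k ih =>
    have h1 : C * e (k + 1) ≤ (C * e k) ^ 2 := by
      have := hstep k
      nlinarith [hC.le]
    have h2 : 0 ≤ C * e k := mul_nonneg hC.le (hpos k)
    calc C * e (k + 1) ≤ (C * e k) ^ 2 := h1
      _ ≤ ((C * e 0) ^ (2 ^ k)) ^ 2 := pow_le_pow_left₀ h2 ih 2
      _ = (C * e 0) ^ (2 ^ (k + 1)) := by rw [← pow_mul, ← pow_succ]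

/-- **Error form** of the quadratic recursion: `e k ≤ (C * e 0) ^ (2 ^ k) / C`. -/
theorem quad_recursion_error {C : ℝ} {e : ℕ → ℝ} (hC : 0 < C) (hpos : ∀ k, 0 ≤ e k)
    (hstep : ∀ k, e (k + 1) ≤ C * e k ^ 2) (k : ℕ) :
    e k ≤ (C * e 0) ^ (2 ^ k) / C := by
  rw [le_div_iff₀ hC, mul_comm]
  exact quad_recursion_bound hC hpos hstep k

/-- **Tolerance count**: `k` steps reach tolerance `τ` as soon as `(C * e 0) ^ (2 ^ k) ≤ C * τ`. -/
theorem quad_recursion_steps {C τ : ℝ} {e : ℕ → ℝ} (hC : 0 < C) (hpos : ∀ k, 0 ≤ e k)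
    (hstep : ∀ k, e (k + 1) ≤ C * e k ^ 2) {k : ℕ}
    (hk : (C * e 0) ^ (2 ^ k) ≤ C * τ) : e k ≤ τ :=
  le_of_mul_le_mul_left ((quad_recursion_bound hC hpos hstep k).trans hk) hC

/-- **Three steps**: `e 3 ≤ C ^ 7 * (e 0) ^ 8`. -/
theorem quad_recursion_three {C : ℝ} {e : ℕ → ℝ} (hC : 0 < C) (hpos : ∀ k, 0 ≤ e k)
    (hstep : ∀ k, e (k + 1) ≤ C * e k ^ 2) : e 3 ≤ C ^ 7 * e 0 ^ 8 := by
  have h : C * e 3 ≤ (C * e 0) ^ (2 ^ 3) := quad_recursion_bound hC hpos hstep 3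
  have h2 : C * e 3 ≤ C * (C ^ 7 * e 0 ^ 8) := by
    calc C * e 3 ≤ (C * e 0) ^ (2 ^ 3) := h
      _ = C * (C ^ 7 * e 0 ^ 8) := by norm_num; ring
  exact le_of_mul_le_mul_left h2 hC

/-- **Monotonicity in the constants**: the three-step bound only improves when `C` and `e 0`
decrease (`C ≤ C'`, `e 0 ≤ ε`  ⇒  `e 3 ≤ C' ^ 7 * ε ^ 8`). -/
theorem quad_recursion_three_mono {C C' ε : ℝ} {e : ℕ → ℝ} (hC : 0 < C) (hpos : ∀ k, 0 ≤ e k)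
    (hstep : ∀ k, e (k + 1) ≤ C * e k ^ 2) (hCC' : C ≤ C') (hε : e 0 ≤ ε) :
    e 3 ≤ C' ^ 7 * ε ^ 8 := by
  have h := quad_recursion_three hC hpos hstep
  have h1 : C ^ 7 ≤ C' ^ 7 := pow_le_pow_left₀ hC.le hCC' 7
  have h2 : e 0 ^ 8 ≤ ε ^ 8 := pow_le_pow_left₀ (hpos 0) hε 8
  have h3 : C ^ 7 * e 0 ^ 8 ≤ C' ^ 7 * ε ^ 8 :=
    mul_le_mul h1 h2 (pow_nonneg (hpos 0) 8) (pow_nonneg (hC.le.trans hCC') 7)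
  exact h.trans h3

/-- **Measured instance** (paper §24.62(7): quadratic constant `≤ 1/3`, first error `≤ 1/5` at
every `n`): three undamped steps from the composite reach `e 3 ≤ 3⁻⁷·5⁻⁸ = 1/854296875 < 1.2·10⁻⁹`
— the observed third-step error is `6·10⁻¹⁰`. -/
theorem quad_recursion_three_measured {C : ℝ} {e : ℕ → ℝ} (hC : 0 < C) (hpos : ∀ k, 0 ≤ e k)
    (hstep : ∀ k, e (k + 1) ≤ C * e k ^ 2) (hC3 : C ≤ 1 / 3) (he0 : e 0 ≤ 1 / 5) :
    e 3 ≤ 1 / 854296875 ∧ e 3 < 1.2e-9 := by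
  have h := quad_recursion_three_mono hC hpos hstep hC3 he0
  have h' : e 3 ≤ 1 / 854296875 := by
    calc e 3 ≤ (1 / 3 : ℝ) ^ 7 * (1 / 5) ^ 8 := h
      _ = 1 / 854296875 := by norm_num
  exact ⟨h', by linarith [show (1 : ℝ) / 854296875 < 1.2e-9 by norm_num]⟩

/-- **Sharpness**: the extremal recursion `e (k+1) = C * (e k)^2` attains the bound,
`C * e k = (C * e 0) ^ (2 ^ k)`. -/
theorem quad_recursion_exact {C : ℝ} {e : ℕ → ℝ}
    (hstep : ∀ k, e (k + 1) = C * e k ^ 2) : ∀ k, C * e k = (C * e 0) ^ (2 ^ k) := by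
  intro k
  induction k with
  | zero => simp
  | succ k ih =>
    calc C * e (k + 1) = (C * e k) ^ 2 := by rw [hstep k]; ring
      _ = ((C * e 0) ^ (2 ^ k)) ^ 2 := by rw [ih]
      _ = (C * e 0) ^ (2 ^ (k + 1)) := by rw [← pow_mul, ← pow_succ]

end Quadratic

section Mixed

/-- **Linear-plus-quadratic recursion** (inexact or simplified Newton; a frozen approximate
inverse contributes the linear part `λ`): if `0 ≤ e k`, `e (k+1) ≤ λ * e k + C * (e k)^2`,
`0 ≤ λ`, `0 ≤ C` and `λ + C * e 0 ≤ q ≤ 1`, then `e k ≤ e 0 * q ^ k` for every `k`. -/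
theorem mixed_recursion_geometric {lam C q : ℝ} {e : ℕ → ℝ} (hlam : 0 ≤ lam) (hC : 0 ≤ C)
    (hq1 : q ≤ 1) (hpos : ∀ k, 0 ≤ e k)
    (hstep : ∀ k, e (k + 1) ≤ lam * e k + C * e k ^ 2)
    (hq : lam + C * e 0 ≤ q) : ∀ k, e k ≤ e 0 * q ^ k := by
  have hq0 : 0 ≤ q := le_trans (add_nonneg hlam (mul_nonneg hC (hpos 0))) hq
  intro k
  induction k with
  | zero => simp
  | succ k ih =>
    have hk0 : e k ≤ e 0 := by
      have hqk : q ^ k ≤ 1 := pow_le_one₀ hq0 hq1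
      calc e k ≤ e 0 * q ^ k := ih
        _ ≤ e 0 * 1 := mul_le_mul_of_nonneg_left hqk (hpos 0)
        _ = e 0 := mul_one _
    have hfac : lam + C * e k ≤ q := by
      have : C * e k ≤ C * e 0 := mul_le_mul_of_nonneg_left hk0 hC
      linarith
    calc e (k + 1) ≤ lam * e k + C * e k ^ 2 := hstep k
      _ = (lam + C * e k) * e k := by ring
      _ ≤ q * e k := mul_le_mul_of_nonneg_right hfac (hpos k)
      _ ≤ q * (e 0 * q ^ k) := mul_le_mul_of_nonneg_left ih hq0
      _ = e 0 * q ^ (k + 1) := by ring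

/-- **The factor improves along the iteration**: under the same hypotheses the per-step factor
`λ + C * e k` is at most `λ + C * e 0 * q ^ k` — the quadratic part dies out geometrically and
the asymptotic rate is the linear part `λ` alone. -/
theorem mixed_recursion_eventually_small {lam C q : ℝ} {e : ℕ → ℝ} (hlam : 0 ≤ lam) (hC : 0 ≤ C)
    (hq1 : q ≤ 1) (hpos : ∀ k, 0 ≤ e k)
    (hstep : ∀ k, e (k + 1) ≤ lam * e k + C * e k ^ 2)
    (hq : lam + C * e 0 ≤ q) (k : ℕ) :
    lam + C * e k ≤ lam + C * (e 0 * q ^ k) ∧ e (k + 1) ≤ (lam + C * (e 0 * q ^ k)) * e k := by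
  have hk := mixed_recursion_geometric hlam hC hq1 hpos hstep hq k
  have h1 : C * e k ≤ C * (e 0 * q ^ k) := mul_le_mul_of_nonneg_left hk hC
  refine ⟨by linarith, ?_⟩
  calc e (k + 1) ≤ lam * e k + C * e k ^ 2 := hstep k
    _ = (lam + C * e k) * e k := by ring
    _ ≤ (lam + C * (e 0 * q ^ k)) * e k := mul_le_mul_of_nonneg_right (by linarith) (hpos k)

/-- **Pure Newton as the case `λ = 0`** of the mixed recursion: with `C * e 0 ≤ q ≤ 1` the errors
decrease at least geometrically, `e k ≤ e 0 * q ^ k` (the crude bound; `quad_recursion_bound`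
is the sharp one). -/
theorem quad_recursion_geometric {C q : ℝ} {e : ℕ → ℝ} (hC : 0 ≤ C) (hq1 : q ≤ 1)
    (hpos : ∀ k, 0 ≤ e k) (hstep : ∀ k, e (k + 1) ≤ C * e k ^ 2) (hq : C * e 0 ≤ q) :
    ∀ k, e k ≤ e 0 * q ^ k :=
  mixed_recursion_geometric (lam := 0) le_rfl hC hq1 hpos
    (fun k => by simpa using hstep k) (by simpa using hq)

end Mixed

end Summit.AnomalousDissipation.AnomalousDissipation.Theorems
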